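import Mathlib
import Literature.NumberTheory.LFunctions.ThetaSmallRange
import Literature.NumberTheory.LFunctions.ChebyshevSylvesterPsi
import HarnessLib

/-!
# Sections of `ζ` beyond `σ = 1`: an explicit envelope for `|θ(t) − t|`, `t ≥ 599`

Barrier catalogue `Literature/Barriers/RiemannHypothesis/`, companion of `TuranPartialSums.lean`
(prime-number input of the "vertical shift" proof of `TuranPartialSums` for large `N`). Everything
is PROVED, by assembling two theorems of the tree:

* `Literature.NumberTheory.LFunctions.abs_theta_sub_le_smallRange` — Schoenfeld's
  `|θ(t) − t| ≤ √t log² t/(8π)` on `599 ≤ t ≤ 8886113`, unconditionally (kernel-certified prime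
  table, `ThetaSmallRange.lean`);
* `Literature.NumberTheory.LFunctions.theta_bounds_sylvester` — the Chebyshev–Sylvester bounds
  `0.9392 t − 9√t − 2√t log t ≤ θ(t) ≤ 1.0722 t + 7√t` for all `t ≥ 1`
  (`ChebyshevSylvesterPsi.lean`).

## Contents (namespace `Literature.Barriers.RiemannHypothesis.TuranShift`)

* `thetaZ = 8886113`, `tableEnv t = √t log² t/(8π)`, `sylvEnv t = 0.0722 t + 10 √t + 2 √t log t`,
  `thetaEnv t = if t ≤ thetaZ then tableEnv t else sylvEnv t`.
* `abs_theta_sub_le_thetaEnv` — `|θ(t) − t| ≤ thetaEnv t` for `t ≥ 599`.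
* `thetaEnv_le_thetaEnv` — the envelope is non-decreasing on `[599, ∞)` (used to pass from the
  values `thetaEnv n` at integers to integrals `∫ thetaEnv`), `thetaEnv_nonneg`,
  `tableEnv_le_sylvEnv_thetaZ` (the jump at `thetaZ` is upward).

Design note. The relative envelope `thetaEnv t / t` is `≤ log² t/(8π√t)` (`≈ 0.066` at `t = 599`,
`≈ 0.0107` at `t = 8886113`) on the table range and `≈ 0.0722 + O(log t/√t)` beyond it; the proof of
`TuranPartialSums` needs it only through weighted integrals, evaluated by a verified checker.
-/

noncomputable section

open Real Set
open scoped Chebyshev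

namespace Literature.Barriers.RiemannHypothesis

namespace TuranShift

/-- The end of the kernel-certified table range of `ThetaSmallRange.lean`. [folklore] -/
def thetaZ : ℝ := 8886113

/-- Schoenfeld's envelope `√t log² t/(8π)`. [folklore] -/
def tableEnv (t : ℝ) : ℝ := Real.sqrt t * Real.log t ^ 2 / (8 * Real.pi)

/-- The Chebyshev–Sylvester envelope `0.0722 t + 10 √t + 2 √t log t`. [folklore] -/
def sylvEnv (t : ℝ) : ℝ := 0.0722 * t + 10 * Real.sqrt t + 2 * Real.sqrt t * Real.log t

/-- The envelope: Schoenfeld's on the table range, Chebyshev–Sylvester's beyond. [folklore] -/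
def thetaEnv (t : ℝ) : ℝ := if t ≤ thetaZ then tableEnv t else sylvEnv t

/-- **`|θ(t) − t| ≤ thetaEnv t` for every real `t ≥ 599`.** [folklore] -/
theorem abs_theta_sub_le_thetaEnv {t : ℝ} (ht : 599 ≤ t) : |θ t - t| ≤ thetaEnv t := by
  unfold thetaEnv
  split_ifs with h
  · exact Literature.NumberTheory.LFunctions.abs_theta_sub_le_smallRange ht h
  · have h1 : (1 : ℝ) ≤ t := by linarith
    obtain ⟨hlo, hhi⟩ := Literature.NumberTheory.LFunctions.theta_bounds_sylvester h1
    have hs : 0 ≤ Real.sqrt t := Real.sqrt_nonneg t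
    have hl : 0 ≤ Real.log t := Real.log_nonneg h1
    have hsl : 0 ≤ Real.sqrt t * Real.log t := mul_nonneg hs hl
    rw [sylvEnv, abs_le]
    constructor <;> nlinarith

/-- `tableEnv` is nonnegative for `t ≥ 1`. [folklore] -/
theorem tableEnv_nonneg {t : ℝ} (ht : 1 ≤ t) : 0 ≤ tableEnv t := by
  unfold tableEnv
  have := Real.log_nonneg ht
  positivity

/-- `sylvEnv` is nonnegative for `t ≥ 1`. [folklore] -/
theorem sylvEnv_nonneg {t : ℝ} (ht : 1 ≤ t) : 0 ≤ sylvEnv t := by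
  unfold sylvEnv
  have := Real.log_nonneg ht
  positivity

/-- `thetaEnv` is nonnegative for `t ≥ 1`. [folklore] -/
theorem thetaEnv_nonneg {t : ℝ} (ht : 1 ≤ t) : 0 ≤ thetaEnv t := by
  unfold thetaEnv
  split_ifs
  · exact tableEnv_nonneg ht
  · exact sylvEnv_nonneg ht

/-- `tableEnv` is non-decreasing on `[1, ∞)`. [folklore] -/
theorem tableEnv_le_tableEnv {a b : ℝ} (ha : 1 ≤ a) (hab : a ≤ b) : tableEnv a ≤ tableEnv b := by
  unfold tableEnv
  have hla : 0 ≤ Real.log a := Real.log_nonneg ha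
  have hlab : Real.log a ≤ Real.log b := Real.log_le_log (by linarith) hab
  have hsab : Real.sqrt a ≤ Real.sqrt b := Real.sqrt_le_sqrt hab
  have h1 : Real.log a ^ 2 ≤ Real.log b ^ 2 := pow_le_pow_left₀ hla hlab 2
  have h2 : Real.sqrt a * Real.log a ^ 2 ≤ Real.sqrt b * Real.log b ^ 2 :=
    mul_le_mul hsab h1 (by positivity) (Real.sqrt_nonneg b)
  exact div_le_div_of_nonneg_right h2 (by positivity)

/-- `sylvEnv` is non-decreasing on `[1, ∞)`. [folklore] -/
theorem sylvEnv_le_sylvEnv {a b : ℝ} (ha : 1 ≤ a) (hab : a ≤ b) : sylvEnv a ≤ sylvEnv b := by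
  unfold sylvEnv
  have hla : 0 ≤ Real.log a := Real.log_nonneg ha
  have hlab : Real.log a ≤ Real.log b := Real.log_le_log (by linarith) hab
  have hsab : Real.sqrt a ≤ Real.sqrt b := Real.sqrt_le_sqrt hab
  have h2 : Real.sqrt a * Real.log a ≤ Real.sqrt b * Real.log b :=
    mul_le_mul hsab hlab hla (Real.sqrt_nonneg b)
  nlinarith

/-- `√thetaZ ≤ 2982`. [folklore] -/
theorem sqrt_thetaZ_le : Real.sqrt thetaZ ≤ 2982 := by
  rw [thetaZ, Real.sqrt_le_left (by norm_num)]
  norm_num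

/-- `log thetaZ ≤ 17`. [folklore] -/
theorem log_thetaZ_le : Real.log thetaZ ≤ 17 := by
  rw [Real.log_le_iff_le_exp (by norm_num [thetaZ]), thetaZ]
  have h1 : Real.exp 17 = Real.exp 1 ^ 17 := by rw [← Real.exp_nat_mul]; norm_num
  rw [h1]
  have h2 := Real.exp_one_gt_d9
  calc (8886113 : ℝ) ≤ (2.7182818283 : ℝ) ^ 17 := by norm_num
    _ ≤ Real.exp 1 ^ 17 := pow_le_pow_left₀ (by norm_num) h2.le 17

/-- At the end of the table the jump of the envelope is upward: `tableEnv thetaZ ≤ sylvEnv thetaZ`.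
[folklore] -/
theorem tableEnv_le_sylvEnv_thetaZ : tableEnv thetaZ ≤ sylvEnv thetaZ := by
  have hs := sqrt_thetaZ_le
  have hl := log_thetaZ_le
  have hs0 : 0 ≤ Real.sqrt thetaZ := Real.sqrt_nonneg _
  have hl0 : 0 ≤ Real.log thetaZ := Real.log_nonneg (by norm_num [thetaZ])
  have hpi : 3 ≤ Real.pi := by linarith [Real.pi_gt_three]
  have h1 : tableEnv thetaZ ≤ 2982 * 17 ^ 2 / (8 * 3) := by
    unfold tableEnv
    have hnum : Real.sqrt thetaZ * Real.log thetaZ ^ 2 ≤ 2982 * 17 ^ 2 :=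
      mul_le_mul hs (pow_le_pow_left₀ hl0 hl 2) (by positivity) (by norm_num)
    calc Real.sqrt thetaZ * Real.log thetaZ ^ 2 / (8 * Real.pi)
        ≤ Real.sqrt thetaZ * Real.log thetaZ ^ 2 / (8 * 3) :=
          div_le_div_of_nonneg_left (by positivity) (by norm_num) (by linarith)
      _ ≤ 2982 * 17 ^ 2 / (8 * 3) := div_le_div_of_nonneg_right hnum (by norm_num)
  have h2 : (0.0722 : ℝ) * thetaZ ≤ sylvEnv thetaZ := by
    unfold sylvEnv
    nlinarith
  have h3 : (2982 : ℝ) * 17 ^ 2 / (8 * 3) ≤ 0.0722 * thetaZ := by norm_num [thetaZ]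
  linarith

/-- **The envelope is non-decreasing on `[599, ∞)`** (indeed on `[1, ∞)`). [folklore] -/
theorem thetaEnv_le_thetaEnv {a b : ℝ} (ha : 1 ≤ a) (hab : a ≤ b) : thetaEnv a ≤ thetaEnv b := by
  unfold thetaEnv
  have hZ1 : (1 : ℝ) ≤ thetaZ := by norm_num [thetaZ]
  split_ifs with h1 h2 h2
  · exact tableEnv_le_tableEnv ha hab
  · push Not at h2
    calc tableEnv a ≤ tableEnv thetaZ := tableEnv_le_tableEnv ha h1
      _ ≤ sylvEnv thetaZ := tableEnv_le_sylvEnv_thetaZ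
      _ ≤ sylvEnv b := sylvEnv_le_sylvEnv hZ1 h2.le
  · exact absurd (hab.trans h2) h1
  · push Not at h1
    exact sylvEnv_le_sylvEnv ha hab

/-- The envelope at an integer `n ≥ 1` bounds it below on `[n, ∞)`: for `n ≤ t`,
`thetaEnv n ≤ thetaEnv t`. [folklore] -/
theorem thetaEnv_natCast_le {n : ℕ} (hn : 1 ≤ n) {t : ℝ} (hnt : (n : ℝ) ≤ t) :
    thetaEnv n ≤ thetaEnv t :=
  thetaEnv_le_thetaEnv (by exact_mod_cast hn) hnt

/-- The error of `θ` at an integer: `|θ(n) − n| ≤ thetaEnv n` for `n ≥ 599`. [folklore] -/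
theorem abs_theta_natCast_sub_le {n : ℕ} (hn : 599 ≤ n) :
    |θ (n : ℝ) - n| ≤ thetaEnv n :=
  abs_theta_sub_le_thetaEnv (by exact_mod_cast hn)

end TuranShift

end Literature.Barriers.RiemannHypothesis
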